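import Summits.AtomisticToContinuum.FouriersLaw.Theses.BondHeatUncertainty
import Summits.AtomisticToContinuum.FouriersLaw.Theses.BoundaryEscapeDeficit

/-!
# Strategist sketch — typed STRENGTHENINGS S⁺ of crux stmt-AtomisticToContinuum-9120 (signatures only)

See STRATEGY-CENSUS.md §Strengthen. Each `def` elaborates over tree vocabulary; nothing here is claimed proved.
-/

noncomputable section

open MeasureTheory Set Filter Topology
open Literature.MathematicalPhysics.KineticTheory.HeatConduction

namespace Summit.AtomisticToContinuum.FouriersLaw.Cruxes.SubdiffusiveBondHeat.Strategist

/-- `K_N(u)` — verbatim the `let K` of route `BoundaryEscapeDeficit`. -/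
def kinCorr (ω₂ lam β γ T : ℝ) (N : ℕ) (u : ℝ) : ℝ :=
  if h : 0 < N then
    ∫ z, ((z.2 ⟨0, h⟩) ^ 2 - T) *
        (∫ y, ((y.2 ⟨0, h⟩) ^ 2 - T) ∂((pinnedChain ω₂ lam β γ).transitionKernel N T T u.toNNReal z))
      ∂((pinnedChain ω₂ lam β γ).gibbsMeasure N T)
  else 0

/-- `θ_N(s) = (γ/T²)∫₀ˢ K_N` — verbatim the `let θ`. -/
def stepResponse (ω₂ lam β γ T : ℝ) (N : ℕ) (s : ℝ) : ℝ :=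
  γ / T ^ 2 * ∫ u in (0 : ℝ)..s, kinCorr ω₂ lam β γ T N u

/-- **S⁺_A (AbelDeficit)** — resolvent / Laplace form of the EW law at the contact:
`(γ/T²) ∫₀^∞ e^{-λu} K_N(u) du ≥ 1 - C √λ` for `λ ∈ [1/(cN²), 1]`, `N ≥ N₀`
(i.e. `(γ/T²)⟨θ₀,(λ-L_N)⁻¹θ₀⟩_{μ_T} ≥ 1 - C√λ`: a LOWER bound on a resolvent quadratic form, the side on which the
non-reversible Dirichlet principle `sup_g {2⟨θ₀,g⟩ - λ‖g‖² - ⟨g,-Sg⟩ - ⟨Ag,(λ-S)⁻¹Ag⟩}` certifies bounds by explicit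
test functions). With `DeficitNonneg` it implies the registered Cesàro stub (Abel ⇒ Cesàro for nonnegative
functions, `(1/t)∫₀ᵗ g ≤ e·λ∫₀^∞e^{-λs}g(s)ds` at `λ = 1/t`). -/
def AbelDeficit : Prop :=
  ∀ ω₂ lam β γ : ℝ, 0 < ω₂ → 0 < lam → 0 < β → 0 < γ → ∀ T : ℝ, 0 < T →
    ∃ C c : ℝ, 0 < c ∧ ∃ N₀ : ℕ, ∀ N : ℕ, N₀ ≤ N → ∀ lam' : ℝ, 1 / (c * (N : ℝ) ^ 2) ≤ lam' → lam' ≤ 1 →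
      1 - C * Real.sqrt lam' ≤
        γ / T ^ 2 * ∫ u in Set.Ioi (0 : ℝ), Real.exp (-(lam' * u)) * kinCorr ω₂ lam β γ T N u

/-- **DeficitNonneg** — the sign companion of `AbelDeficit`: the boundary kinetic temperature never overshoots
to first order, `θ_N(s) ≤ 1` for all `s ≥ 0` (⟺ `t ↦ Var_eq(Q^L_t)` has nonnegative growth rate `2γT²(1-θ_N)`). -/
def DeficitNonneg : Prop :=
  ∀ ω₂ lam β γ : ℝ, 0 < ω₂ → 0 < lam → 0 < β → 0 < γ → ∀ T : ℝ, 0 < T →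
    ∀ N : ℕ, 0 < N → ∀ s : ℝ, 0 ≤ s → stepResponse ω₂ lam β γ T N s ≤ 1

/-- **S⁺_B (pointwise return law, `K`-form)** — `|K_N(u)| ≤ A u^{-3/2}` for all `u ≥ 1`, `N ≥ N₀`: the sharp
first-return law of the boundary kinetic-temperature autocorrelation (no window needed; implies the transient
EW law by `1 - θ_N(s) - E_N = (γ/T²)∫_s^∞ K_N`, landed `TransientFormula`). -/
def BoundaryReturnLaw : Prop :=
  ∀ ω₂ lam β γ : ℝ, 0 < ω₂ → 0 < lam → 0 < β → 0 < γ → ∀ T : ℝ, 0 < T →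
    ∃ A : ℝ, ∃ N₀ : ℕ, ∀ N : ℕ, N₀ ≤ N → ∀ u : ℝ, 1 ≤ u →
      |kinCorr ω₂ lam β γ T N u| ≤ A / u ^ (3 / 2 : ℝ)

/-- **S⁺_C (dyadic boundary memory decay = triad C⁺₁)** — `‖P_sθ₀‖²_{L²(μ_T)} ≤ C s^{-3/2}` along `s = 2^k ≤ cN²`:
the monotone quantity (`d/ds ‖P_sθ₀‖² = -2γT Σ_b ‖∂_{p_b}P_sθ₀‖² ≤ 0`) whose induction on dyadic scales would need a
boundary-Nash inequality. Here `‖P_sθ₀‖²` is written as `∫ (P_sθ₀)² dμ_T`. -/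
def BoundaryMemoryDecay : Prop :=
  ∀ ω₂ lam β γ : ℝ, 0 < ω₂ → 0 < lam → 0 < β → 0 < γ → ∀ T : ℝ, 0 < T →
    ∃ C c : ℝ, 0 < c ∧ ∃ N₀ : ℕ, ∀ N : ℕ, N₀ ≤ N → (hN : 0 < N) → ∀ k : ℕ, (2 : ℝ) ^ k ≤ c * (N : ℝ) ^ 2 →
      (∫ z, (∫ y, ((y.2 ⟨0, hN⟩) ^ 2 - T)
          ∂((pinnedChain ω₂ lam β γ).transitionKernel N T T ((2 : ℝ) ^ k).toNNReal z)) ^ 2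
        ∂((pinnedChain ω₂ lam β γ).gibbsMeasure N T)) ≤ C / ((2 : ℝ) ^ k) ^ (3 / 2 : ℝ)

/-- Sanity: the crux itself elaborates from this file's imports. -/
example : Prop := Summit.AtomisticToContinuum.FouriersLaw.Theses.BondHeatUncertainty.SubdiffusiveBondHeat

end Summit.AtomisticToContinuum.FouriersLaw.Cruxes.SubdiffusiveBondHeat.Strategist

end
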